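import Literature.NumberTheory.EllipticCurves.HasseWeilAbelianEulerFactorHoldsProofs
import Literature.NumberTheory.EllipticCurves.HasseWeilGoodReductionProofs
import Literature.NumberTheory.EllipticCurves.HasseWeilAbelianUnramifiedProofs
import HarnessLib

/-!
# Euler factors of `V_ℓ E`: `det(1 - σ T ∣ (V_ℓ E)_{I_𝔓}) = L_v(E, T)` for *every* prime `𝔓 ∣ v`
# and *every* arithmetic Frobenius `σ`

`Proofs` file (theorems only) in topic `NumberTheory/EllipticCurves`, landed bottom-up for the
named fact `WeierstrassCurve.LSeries_baseChange_quadratic` (Ireland–Rosen, Prop. 20.5.4(b): Artin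
formalism `L(E_K/K, s) = L(E, s) L(E^{(d_K)}, s)` for a quadratic field `K`).  The tree's theorem
`WeierstrassCurve.hasseWeilEulerFactor_geomPoints_of_isElliptic_holds`
(`HasseWeilAbelianEulerFactorHoldsProofs`; Silverman, *AEC*, C.§16; Serre–Tate, Thm. 3) identifies
`Literature.NumberTheory.EllipticCurves.hasseWeilEulerFactor` — the reversed characteristic
polynomial of the arithmetic Frobenius on the inertia coinvariants for the pair `(𝔓, σ)` **chosen
in its definition** — with Mathlib's local polynomial `W.localPolynomialAt v`.  Comparing the
Euler factors of `E/ℚ`, `E^{(D)}/ℚ` and `E_K/K` requires the same identity at a *prescribed* prime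
`𝔓 ∣ v` (the one below a prime of `\bar ℤ_K`) and a prescribed Frobenius, so this file re-assembles
the four cases of the tree's proof, each of which is already stated for all pairs:

* good reduction — `hasFrobCharpolyAt_rationalTateGaloisRepOf_of_hasGoodReductionAt` with the
  discharged trace/determinant facts (`HasseWeilGoodReductionProofs`) and unramifiedness
  (`isUnramifiedAt_rationalTateGaloisRepOf_geomPoints`, Silverman VII.4.1);
* split / non-split multiplicative reduction —
  `toInertiaCoinvariants_eq_id_of_hasSplitMultiplicativeReductionAt_of_frobenius_torsion`,
  `inertiaCoinvariants_rationalTate_of_hasNonsplitMultiplicativeReductionAt_of_codim_of_frobenius`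
  with `codimFixed_inertia_rationalTate_eq_one_of_hasMultiplicativeReductionAt_holds` and the
  Serre–Tate Frobenius-torsion theorems;
* additive reduction — `inertiaCoinvariants_rationalTate_eq_zero_of_hasAdditiveReductionAt_of_codim`
  with the Kodaira–Néron additive case, as in `HasseWeilAbelianEulerFactorHoldsProofs`;

into `WeierstrassCurve.reverse_charpoly_toInertiaCoinvariants_eq_localPolynomialAt`:
for an elliptic curve over a number field, a prime `ℓ`, a place `v ∤ ℓ`, **any** `𝔓 ∣ v` and
**any** arithmetic Frobenius `σ ∈ D_𝔓`,
`(σ ∣ (V_ℓ E)_{I_𝔓}).charpoly.reverse = (W.localPolynomialAt v).map (ℤ → ℚ_ℓ)`.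

## References

* J. H. Silverman, *The Arithmetic of Elliptic Curves*, 2nd ed. (2009), §C.16, C.21 Rem. 21.3.
  [SilvermanAEC2009]
* J.-P. Serre, J. Tate, *Good reduction of abelian varieties*, Ann. of Math. 88 (1968), Thm. 3.
  [SerreTate1968]
* K. Ireland, M. Rosen, *A Classical Introduction to Modern Number Theory*, 2nd ed. (1990),
  Prop. 20.5.4(b). [IrelandRosen1990]
-/

noncomputable section

open scoped Classical
open NumberField IsDedekindDomain Field Polynomial

universe u

namespace WeierstrassCurve

open Literature.NumberTheory.EllipticCurves Literature.NumberTheory.GaloisRepresentations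

variable {K : Type u} [Field K] [NumberField K] (W : WeierstrassCurve K) [W.IsElliptic]
  (ℓ : ℕ) [Fact ℓ.Prime]

/-- **`det(1 - σ T ∣ (V_ℓ E)_{I_𝔓}) = L_v(E, T)` for every `𝔓 ∣ v` and every arithmetic
Frobenius `σ`.**  Let `E/K` be an elliptic curve over a number field, `ℓ` a prime, `v ∤ ℓ` a
finite place, `𝔓` any prime of `\bar ℤ_K` above `v` and `σ ∈ D_𝔓` any arithmetic Frobenius at
`𝔓`.  Then the reversed characteristic polynomial of `σ` on the inertia coinvariants
`(V_ℓ E)_{I_𝔓}` is Mathlib's local polynomial `L_v(E, T)` (`1 - a_v T + q_v T²`, `1 - T`, `1 + T`,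
`1` by reduction type), viewed in `ℚ_ℓ[T]`.  This is the pair-independent form of the tree's
`hasseWeilEulerFactor_geomPoints_of_isElliptic_holds` (which concerns the pair chosen in the
definition of `hasseWeilEulerFactor`), assembled from the same four cases.  Silverman, *AEC*,
§C.16; Serre–Tate, Thm. 3. [cite: SilvermanAEC2009, §C.16 (PDF p. 390)]
[cite: SerreTate1968, §2 Thm. 3] -/
theorem reverse_charpoly_toInertiaCoinvariants_eq_localPolynomialAt
    (h : Continuous fun x : absoluteGaloisGroup K × RationalTateModule (geomPoints W) ℓ ↦
      rationalTateRepresentation (absoluteGaloisGroup K) (geomPoints W) ℓ x.1 x.2)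
    [Module.Finite ℚ_[ℓ] (W.rationalTateModule ℓ)]
    {v : HeightOneSpectrum (𝓞 K)} (hℓ : (ℓ : 𝓞 K) ∉ v.asIdeal)
    {𝔓 : Ideal (absIntegers (𝓞 K) K)} (h𝔓 : 𝔓 ∈ v.primesAbove)
    (σ : 𝔓.decompositionSubgroup (absoluteGaloisGroup K))
    (hσ : IsArithFrobAt (𝓞 K) (σ : absoluteGaloisGroup K) 𝔓) :
    ((rationalTateGaloisRepOf (geomPoints W) ℓ h).toInertiaCoinvariants 𝔓 σ).charpoly.reverse =
      (W.localPolynomialAt v).map (Int.castRingHom ℚ_[ℓ]) := by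
  rcases hasGoodReductionAt_or_hasMultiplicativeReductionAt_or_hasAdditiveReductionAt v W with
    hg | hm | ha
  · -- good reduction: unramified, `charpoly (ρ σ) = X² - a X + q`
    have hunr := W.isUnramifiedAt_rationalTateGaloisRepOf_geomPoints ℓ h hg hℓ
    have hP := hasFrobCharpolyAt_rationalTateGaloisRepOf_of_hasGoodReductionAt
      (W.trace_galoisRepTate_frobenius_of_hasGoodReductionAt_holds ℓ)
      (W.det_galoisRepTate_frobenius_of_hasGoodReductionAt_holds ℓ) h hℓ hg
    rw [ContinuousRep.charpoly_toInertiaCoinvariants _ _ (hunr _ h𝔓), hP _ h𝔓 _ hσ,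
      localPolynomialAt_of_hasGoodReductionAt hg, Polynomial.reverse_X_sq_sub_C_mul_X_add_C]
    simp [Polynomial.map_sub]
  · by_cases hs : W.HasSplitMultiplicativeReductionAt v
    · -- split multiplicative: a line with trivial Frobenius
      obtain ⟨h1, hid⟩ :=
        W.toInertiaCoinvariants_eq_id_of_hasSplitMultiplicativeReductionAt_of_frobenius_torsion ℓ
          (W.codimFixed_inertia_rationalTate_eq_one_of_hasMultiplicativeReductionAt_holds ℓ)
          (W.serreTate_frobenius_smul_torsion_of_hasSplitMultiplicativeReductionAt_holds ℓ)
          h hℓ hs h𝔓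
      rw [LinearMap.charpoly_eq_X_sub_C_of_finrank_eq_one h1 1 (by rw [hid σ hσ, one_smul]),
        Polynomial.reverse_X_sub_C', localPolynomialAt_of_hasSplitMultiplicativeReductionAt hs]
      simp
    · -- non-split multiplicative: a line with Frobenius `-1`
      have hN : W.inertiaCoinvariants_rationalTate_of_hasNonsplitMultiplicativeReductionAt ℓ :=
        W.inertiaCoinvariants_rationalTate_of_hasNonsplitMultiplicativeReductionAt_of_codim_of_frobenius
          ℓ (W.codimFixed_inertia_rationalTate_eq_one_of_hasMultiplicativeReductionAt_holds ℓ)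
          (W.frobenius_smul_fixedSubmodule_inertia_rationalTate_of_hasNonsplitMultiplicativeReductionAt_of_torsion
            ℓ (W.serreTate_frobenius_smul_torsion_of_hasNonsplitMultiplicativeReductionAt_holds ℓ))
      obtain ⟨h1, hneg⟩ := hN h v hℓ hm hs h𝔓
      rw [LinearMap.charpoly_eq_X_sub_C_of_finrank_eq_one h1 (-1)
          (by rw [hneg σ hσ, neg_smul, one_smul]),
        Polynomial.reverse_X_sub_C',
        localPolynomialAt_of_hasMultiplicativeReductionAt_of_not_hasSplitMultiplicativeReductionAt
          hm hs]
      simp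
  · -- additive: the coinvariants vanish
    have hA : W.inertiaCoinvariants_rationalTate_eq_zero_of_hasAdditiveReductionAt ℓ :=
      W.inertiaCoinvariants_rationalTate_eq_zero_of_hasAdditiveReductionAt_of_codim ℓ
        (W.codimFixed_inertia_rationalTate_eq_two_of_hasAdditiveReductionAt_of_kodairaNeron_additive
          ℓ fun _ hv ↦
            W.kodairaNeron_exists_finset_reducesToNonsingular_of_hasAdditiveReductionAt hv)
    rw [LinearMap.charpoly_eq_one_of_finrank_eq_zero (hA h v hℓ ha h𝔓), Polynomial.reverse_one',
      localPolynomialAt_of_hasAdditiveReductionAt ha, Polynomial.map_one]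

/-- The same with the continuity and finiteness of `V_ℓ E` supplied by the tree
(`continuous_rationalGaloisRepTate_holds`, `module_finite_rationalTateModule_holds`): for every
`𝔓 ∣ v ∤ ℓ` and every arithmetic Frobenius `σ` at `𝔓`,
`(σ ∣ (V_ℓ E)_{I_𝔓}).charpoly.reverse = L_v(E, T)`. [cite: SilvermanAEC2009, §C.16 (PDF p. 390)] -/
theorem reverse_charpoly_toInertiaCoinvariants_eq_localPolynomialAt'
    {v : HeightOneSpectrum (𝓞 K)} (hℓ : (ℓ : 𝓞 K) ∉ v.asIdeal)
    {𝔓 : Ideal (absIntegers (𝓞 K) K)} (h𝔓 : 𝔓 ∈ v.primesAbove)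
    (σ : 𝔓.decompositionSubgroup (absoluteGaloisGroup K))
    (hσ : IsArithFrobAt (𝓞 K) (σ : absoluteGaloisGroup K) 𝔓) :
    haveI := W.module_finite_rationalTateModule_holds ℓ
    ((rationalTateGaloisRepOf (geomPoints W) ℓ
        (W.continuous_rationalGaloisRepTate_holds ℓ)).toInertiaCoinvariants 𝔓 σ).charpoly.reverse =
      (W.localPolynomialAt v).map (Int.castRingHom ℚ_[ℓ]) :=
  haveI := W.module_finite_rationalTateModule_holds ℓ
  W.reverse_charpoly_toInertiaCoinvariants_eq_localPolynomialAt ℓ _ hℓ h𝔓 σ hσ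

end WeierstrassCurve

end
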